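import Summits.HodgeConjecture.HodgeConjecture.Theorems.LinearSystemTorelliLocalTubeSpanQuotientTransfer
import Summits.HodgeConjecture.HodgeConjecture.Theorems.LinearSystemTorelliLocalTubeSpanFrameLift
import Summits.HodgeConjecture.HodgeConjecture.Theorems.LinearSystemTorelliLocalTubeSpanRadical
import Summits.HodgeConjecture.HodgeConjecture.Theorems.LinearSystemTorelliLocalTubeSpanTypedInstances

/-!
# Route LinearSystemTorelli — crux `LocalTubeSpan` (stmt-HodgeConjecture-2490): Schnell's Lemma 11 for degenerate lattices from the nondegenerate case

Helper file (`--supports stmt-HodgeConjecture-2490`, line `Sketch` of the crux chain, cycle 6,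
continuation lead c5; composition `schnell2010_lemma11_of_nondegenerate` of the skeleton).

The named fact `Schnell2010_lemma11` of `Literature/AlgebraicGeometry/HodgeTheory/SkewVanishingLattice`
(C. Schnell, *Primitive cohomology and the tube mapping*, Math. Z. 268 (2010) §7 Lemma 11, from
Janssen's Theorem 2.5 and Lemma 2.7) is stated, as printed, for an ARBITRARY alternating form —
possibly degenerate — and the line uses it in the degenerate case: the local lattice at a
non-isolated member `Y₁ ∪ Y₂` of the linear system is a complete skew vanishing lattice modulo a
RADICAL (`localTubeSpan_injective_evalCoinv_of_completeOrbit`, file `…Radical`).  Lead c4 asked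
whether that degenerate use reduces to the nondegenerate Lemma 11 (Schnell's own setting: vanishing
cohomology with its nondegenerate intersection form).  It does:

* `localTubeSpan_schnell2010_lemma11_of_nondegenerate` — Lemma 11 for NONDEGENERATE lattices
  implies `Schnell2010_lemma11` (all lattices): push the lattice to the nondegenerate quotient
  `V / ker B` (`localTubeSpan_quotientTransfer`), lift the frame and complete it, and compare the
  unipotent parts by rank (`localTubeSpan_frameLift`);
* `localTubeSpan_injective_evalCoinv_of_completeOrbit_of_nondegenerate` — consequently the local
  Schnell theorem at a one-branch point (one complete orbit with radical: the members `Y₁ ∪ Y₂`)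
  holds granting only the nondegenerate Lemma 11;
* `localTubeSpan_injective_evalCoinv_res_rat_of_completeOrbit_of_nondegenerate` — the same on the
  tree's hyperplane-section package (rational monodromy restricted to a local subgroup), i.e. the
  typed complete-orbit instance of `…TypedInstances` with the weaker arithmetic input.

The hypothesis is written out (a `∀`-statement, verbatim `Schnell2010_lemma11` plus
`B.Nondegenerate`); no new definition, no named fact beyond it; no `sorry`.
-/

-- `Summit.HodgeConjecture.HodgeConjecture.Theorems` is the mandated namespace (single-conjunct summit:
-- Sub = Summit), which `linter.dupNamespace` flags on every declaration; the lakefile turns the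
-- linter off tree-wide (weak option), restated here so stand-alone elaboration is warning-free too.
set_option linter.dupNamespace false

noncomputable section

open CategoryTheory groupCohomology
open Literature.AlgebraicGeometry.HodgeTheory

namespace Summit.HodgeConjecture.HodgeConjecture.Theorems

/-- **Schnell's Lemma 11 for arbitrary (possibly degenerate) skew vanishing lattices follows from
its nondegenerate case.**  If for every NONDEGENERATE alternating form on a finite-dimensional
`ℚ`-space and every skew vanishing lattice `Δ` there are `dim` linearly independent elements of `Δ`
whose transvection group has finite index in `Γ_Δ`, then the same holds for every alternating form
(the tree's named fact `Schnell2010_lemma11`).  Proof: `localTubeSpan_quotientTransfer` (the quotient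
by the radical is a nondegenerate skew vanishing lattice; a frame downstairs lifts to elements of
`Δ` independent modulo the radical, with finitely many cosets modulo frame-group·unipotents) and
`localTubeSpan_frameLift` (complete the lifted frame inside `Δ`; the unipotent part of `Γ_Δ` is a
lattice of shears of rank `≤ dim(V/R)·dim R`, met by the frame group in a sublattice of full rank).
[cite: Schnell2010, §7 Lemma 11] -/
theorem localTubeSpan_schnell2010_lemma11_of_nondegenerate
    (hL11nd : ∀ (W : Type) [AddCommGroup W] [Module ℚ W] [FiniteDimensional ℚ W]
      (Bq : LinearMap.BilinForm ℚ W), Bq.IsAlt → Bq.Nondegenerate → ∀ Δq : Set W,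
      IsSkewVanishingLattice Bq Δq →
        ∃ (r : ℕ) (δ : Fin r → W), r = Module.finrank ℚ W ∧ (∀ i, δ i ∈ Δq) ∧
          LinearIndependent ℚ δ ∧
          ((transvectionGroup Bq (Set.range δ)).subgroupOf (transvectionGroup Bq Δq)).FiniteIndex) :
    Schnell2010_lemma11 := by
  intro V _ _ _ B hB Δ hΔ
  obtain ⟨r, δ, hr, hδΔ, hli, C, hC, hcos⟩ := localTubeSpan_quotientTransfer hL11nd B hB Δ hΔ
  exact localTubeSpan_frameLift B hB Δ hΔ δ hr hδΔ hli C hC hcos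

/-- **The local Schnell theorem at a one-branch point, granting only the NONDEGENERATE Lemma 11.**
The setting of `localTubeSpan_injective_evalCoinv_of_completeOrbit` (file `…Radical`): `G` acts on
the finite-dimensional `ℚ`-space `V` with alternating form `B`, generated by elements acting as
Picard–Lefschetz transvections along a `G`-stable single orbit `Δ` (integral, `ℤΔ` finitely
generated, with a pair `⟨δ₁, δ₂⟩ = 1`, every `T_δ` realised) — a skew vanishing lattice in its own
span `L = ℚΔ` whose form is in general DEGENERATE (the radical is the locally visible homology of the
member `Y₁ ∪ Y₂`).  Then Schnell's third map `H¹(G, V) → ∏_g V/(g - 1)V` is injective, granting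
Lemma 11 for nondegenerate lattices only (`localTubeSpan_schnell2010_lemma11_of_nondegenerate`).
[cite: Schnell2010, §7 Prop. 12 and Lemma 11] -/
theorem localTubeSpan_injective_evalCoinv_of_completeOrbit_of_nondegenerate
    (hL11nd : ∀ (W : Type) [AddCommGroup W] [Module ℚ W] [FiniteDimensional ℚ W]
      (Bq : LinearMap.BilinForm ℚ W), Bq.IsAlt → Bq.Nondegenerate → ∀ Δq : Set W,
      IsSkewVanishingLattice Bq Δq →
        ∃ (r : ℕ) (δ : Fin r → W), r = Module.finrank ℚ W ∧ (∀ i, δ i ∈ Δq) ∧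
          LinearIndependent ℚ δ ∧
          ((transvectionGroup Bq (Set.range δ)).subgroupOf (transvectionGroup Bq Δq)).FiniteIndex)
    {G : Type} [Group G] (A : Rep ℚ G)
    [FiniteDimensional ℚ A.V] (B : LinearMap.BilinForm ℚ A.V) (hB : B.IsAlt) (Δ : Set A.V)
    (s : Set G) (hs : Subgroup.closure s = ⊤)
    (hsΔ : ∀ t ∈ s, ∃ δ ∈ Δ, ∀ x : A.V, A.ρ t x = x - B x δ • δ)
    (hΔG : ∀ δ ∈ Δ, ∃ g : G, ∀ x : A.V, A.ρ g x = x - B x δ • δ)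
    (hfg : (Submodule.span ℤ Δ).FG) (hint : ∀ δ ∈ Δ, ∀ δ' ∈ Δ, ∃ n : ℤ, B δ δ' = n)
    (hstable : ∀ (g : G), ∀ δ ∈ Δ, A.ρ g δ ∈ Δ)
    (htrans : ∀ δ ∈ Δ, ∀ δ' ∈ Δ, ∃ g : G, A.ρ g δ = δ')
    (hpair : ∃ δ₁ ∈ Δ, ∃ δ₂ ∈ Δ, B δ₁ δ₂ = 1) :
    Function.Injective (evalCoinv A) :=
  localTubeSpan_injective_evalCoinv_of_completeOrbit A
    (localTubeSpan_schnell2010_lemma11_of_nondegenerate hL11nd) B hB Δ s hs hsΔ hΔG hfg hint hstable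
    htrans hpair


/-! ### On the tree's hyperplane-section package -/

section Typed

open Literature.AlgebraicGeometry Literature.AlgebraicTopology.SingularHomology

variable {𝒳 Sb : Motives.SchemeOver ℂ} {π : 𝒳 ⟶ Sb} {n : ℕ}

/-- **`ℚ`-cyclic detection at a local subgroup presented by ONE COMPLETE ORBIT, granting only the
NONDEGENERATE Lemma 11** — the typed complete-orbit instance
`localTubeSpan_injective_evalCoinv_res_rat_of_completeOrbit` (file `…TypedInstances`: `S ≤ π₁(U, s)`
generated by elements acting on `Hᵏ(X_s(ℂ); ℚ)` through the rational monodromy as transvections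
along a realised, finitely generated, integral, `S`-stable single orbit `Δ` with a pair
`⟨δ₁, δ₂⟩ = 1`) with `Schnell2010_lemma11` replaced by its nondegenerate case.
[cite: Schnell2010, §7 Prop. 12 and Lemma 11] -/
theorem localTubeSpan_injective_evalCoinv_res_rat_of_completeOrbit_of_nondegenerate
    (hL11nd : ∀ (W : Type) [AddCommGroup W] [Module ℚ W] [FiniteDimensional ℚ W]
      (Bq : LinearMap.BilinForm ℚ W), Bq.IsAlt → Bq.Nondegenerate → ∀ Δq : Set W,
      IsSkewVanishingLattice Bq Δq →
        ∃ (r : ℕ) (δ : Fin r → W), r = Module.finrank ℚ W ∧ (∀ i, δ i ∈ Δq) ∧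
          LinearIndependent ℚ δ ∧
          ((transvectionGroup Bq (Set.range δ)).subgroupOf (transvectionGroup Bq Δq)).FiniteIndex)
    (D : DirectImageLocalSystem π n) (k : ℕ) (s : smoothFiberLocus π n)
    (S : Subgroup (FundamentalGroup (smoothFiberLocus π n) s))
    (B : LinearMap.BilinForm ℚ (Motives.bettiCohomology (Motives.fiberOver π s.1) k)) (hB : B.IsAlt)
    (Δ : Set (Motives.bettiCohomology (Motives.fiberOver π s.1) k)) (gen : Set S)
    (hgen : Subgroup.closure gen = ⊤)
    (hgenΔ : ∀ t ∈ gen, ∃ δ ∈ Δ, ∀ x,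
      D.ratMonodromy k s (t : FundamentalGroup (smoothFiberLocus π n) s) x = x - B x δ • δ)
    (hΔS : ∀ δ ∈ Δ, ∃ g : S, ∀ x,
      D.ratMonodromy k s (g : FundamentalGroup (smoothFiberLocus π n) s) x = x - B x δ • δ)
    (hfg : (Submodule.span ℤ Δ).FG) (hint : ∀ δ ∈ Δ, ∀ δ' ∈ Δ, ∃ z : ℤ, B δ δ' = z)
    (hstable : ∀ (g : S), ∀ δ ∈ Δ,
      D.ratMonodromy k s (g : FundamentalGroup (smoothFiberLocus π n) s) δ ∈ Δ)
    (htrans : ∀ δ ∈ Δ, ∀ δ' ∈ Δ, ∃ g : S,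
      D.ratMonodromy k s (g : FundamentalGroup (smoothFiberLocus π n) s) δ = δ')
    (hpair : ∃ δ₁ ∈ Δ, ∃ δ₂ ∈ Δ, B δ₁ δ₂ = 1) :
    Function.Injective (evalCoinv (Rep.res S.subtype (Rep.of (D.ratMonodromy k s)))) :=
  localTubeSpan_injective_evalCoinv_res_rat_of_completeOrbit
    (localTubeSpan_schnell2010_lemma11_of_nondegenerate hL11nd) D k s S B hB Δ gen hgen hgenΔ hΔS hfg
    hint hstable htrans hpair

end Typed

end Summit.HodgeConjecture.HodgeConjecture.Theorems

end
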